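import Mathlib
import Summits.Ventures.PercRepro2.TB14MarkEdge

/-!
# The unmarked edge at the mark: the exact four-piece defect (typed BHK 1.4): Theorem T
(blind cell PercRepro2, mine-c g20, 2026-08-25; `conjectures/MINE-C.md` §29.9)

For a free edge `e = b z` from the mark `b` to an UNMARKED vertex `z` (`z ∉ {a₁, a₂, o}`), splitting
the two-copy sum of the folded kernel on `e` (`pairCount_foldK_markEdge`) gives the defect
`foldK (y₂[e ↦ 1]) w₂ + foldK y₂ (w₂[e ↦ 1]) − foldK y₂ w₂`, first copy `y` blue, second copy `w`
red.  With the edge open in the blue copy the mark's blue cluster is `K_b ∪ (K_b ∋ z ? …)`, i.e.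
`b ∈ C_{y'}(a₁)` iff `b ∈ K_b ∨ z ∈ K_b`, and `Q` in the blue copy additionally forbids the blue
edge joining `K_b` to `M_b` (`b ∈ K_b ∧ z ∈ M_b` or `z ∈ K_b ∧ b ∈ M_b`); with the edge open in the
red copy `Q` forbids the red edge joining `K_r` to `M_r`, and `o` may be CAPTURED by `M_r` through
the new edge.  Sorting the cases, the defect is the POINTWISE identity (`markEdgeDefect_unmarked_eq`)

  `defect = FAV + PIV + CAP − LOSS`,

`FAV = 1_Q 1_Q [b ∈ K_b][z ∉ M_b] ε_o` (the row's kernel with the favourable conditioning `z ∉ M_b`),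
`PIV = 1_Q 1_Q [z ∈ K_b][b ∉ K_b][b ∉ M_b] ε_o` (the pivotal term: the new edge is the mark's only
blue route to `a₁`), `CAP = 1_Q 1_Q [b ∈ K_b] ([o ∈ M_r′] − [o ∈ M_r]) ≥ 0` (the red capture of `o`
through the new edge, `M_r′` the red cluster of `a₂` with the edge open) and
`LOSS = 1_Q 1_Q [b ∈ K_b] ([b ∈ K_r][z ∈ M_r] + [z ∈ K_r][b ∈ M_r]) ([o ∈ M_r′] − [o ∈ M_b])` (the
configurations of `G − e` that leave `Q` when the red edge joins the red clusters of the roots).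
Hence (`pairCount_foldK_unmarkedEdge`)

  `D(G) = D(G − b z) + FAV + PIV + CAP − LOSS`   at every profile in which `b z` is free;

`CAP ≥ 0` pointwise, the other three are global, and (MARK-EDGE-MONO) at an unmarked `z` —
`D(G − bz) ≤ D(G)` — is exactly `FAV + PIV + CAP ≥ LOSS`.  Exact check
`data/mine-c/g20/scripts/unmarked.py` (an independent brute force of every piece: every connected
graph with n ≤ 6, every marking `(a₁, a₂, b, o, z)`, every free edge `b z` — 1,560 + 45,648
instances, 0 failures).  Own work; standard axioms.
-/

namespace Summit.Ventures.PercRepro2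

namespace TB14Cut

open CovForm A3InactiveTyped

section UnmarkedEdge

variable {V : Type} {E : Type} [Fintype E] [DecidableEq E] {R : Type*} [Field R]
variable {ends : E → Sym2 V} {e : E} {a₁ a₂ b o z : V}

/-- The favourable piece: the row's kernel with `z ∉ M_b`. -/
noncomputable def unmFav (ends : E → Sym2 V) (a₁ a₂ b o z : V) : Config E → Config E → R :=
  fun y w => iQ ends a₁ a₂ y * iQ ends a₁ a₂ w * iL ends a₁ b y * (1 - iH ends a₂ z y) *
    (iH ends a₂ o w - iH ends a₂ o y)

/-- The pivotal piece: `z` blue at `a₁`, the mark in neither blue cluster. -/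
noncomputable def unmPivot (ends : E → Sym2 V) (a₁ a₂ b o z : V) : Config E → Config E → R :=
  fun y w => iQ ends a₁ a₂ y * iQ ends a₁ a₂ w * iL ends a₁ z y * (1 - iL ends a₁ b y) *
    (1 - iH ends a₂ b y) * (iH ends a₂ o w - iH ends a₂ o y)

/-- `1[o ∈ M_r′]`: `o` in the red cluster of `a₂` after the red edge `b z` is added
(`o ∈ M_r`, or `b ∈ M_r` and `z ~_r o`, or `z ∈ M_r` and `b ~_r o`). -/
noncomputable def capInd (ends : E → Sym2 V) (a₂ b o z : V) : Config E → R :=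
  fun w => 1 - (1 - iH ends a₂ o w) * (1 - iH ends a₂ b w * iL ends z o w) *
    (1 - iH ends a₂ z w * iL ends b o w)

/-- The capture piece: `o` enters `M_r` through the new red edge (pointwise nonnegative). -/
noncomputable def unmCapture (ends : E → Sym2 V) (a₁ a₂ b o z : V) : Config E → Config E → R :=
  fun y w => iQ ends a₁ a₂ y * iQ ends a₁ a₂ w * iL ends a₁ b y *
    (capInd ends a₂ b o z w - iH ends a₂ o w)

/-- The loss piece: the red edge joins the red clusters of the roots. -/
noncomputable def unmLoss (ends : E → Sym2 V) (a₁ a₂ b o z : V) : Config E → Config E → R :=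
  fun y w => iQ ends a₁ a₂ y * iQ ends a₁ a₂ w * iL ends a₁ b y *
    (iL ends a₁ b w * iH ends a₂ z w + iL ends a₁ z w * iH ends a₂ b w) *
    (capInd ends a₂ b o z w - iH ends a₂ o y)

omit [Fintype E] [DecidableEq E] in
/-- The indicator of a disjunction. -/
lemma ite_or_eq (P Q : Prop) [Decidable P] [Decidable Q] :
    (if P ∨ Q then (1 : R) else 0) =
      (if P then 1 else 0) + (if Q then 1 else 0) - (if P then 1 else 0) * (if Q then 1 else 0) := by
  by_cases hP : P <;> by_cases hQ : Q <;> simp [hP, hQ]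

omit [Fintype E] [DecidableEq E] in
/-- The indicator of a conjunction. -/
lemma ite_and_eq (P Q : Prop) [Decidable P] [Decidable Q] :
    (if P ∧ Q then (1 : R) else 0) = (if P then 1 else 0) * (if Q then 1 else 0) := by
  by_cases hP : P <;> by_cases hQ : Q <;> simp [hP, hQ]

omit [Fintype E] in
/-- The Boolean core of Theorem T, the case `b ∈ K_b` (`B1`). -/
lemma unmarked_key_B1 (A1 A2 B1 Z1 C1 Y1 O1 B2 Z2 C2 Y2 O2 Rb1 Rz1 Rb2 Rz2 : Prop)
    [Decidable A1] [Decidable A2] [Decidable B1] [Decidable Z1] [Decidable C1] [Decidable Y1]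
    [Decidable O1] [Decidable B2] [Decidable Z2] [Decidable C2] [Decidable Y2] [Decidable O2]
    [Decidable Rb1] [Decidable Rz1] [Decidable Rb2] [Decidable Rz2]
    (hBC1 : B1 → C1 → A1) (hBC2 : B2 → C2 → A2) (hZY2 : Z2 → Y2 → A2) (hA1 : ¬ A1) (hA2 : ¬ A2)
    (hB1 : B1) :
    (if A1 ∨ (B1 ∧ Y1) ∨ (Z1 ∧ C1) then (0 : R) else 1) * (if A2 then 0 else 1) *
          (if B1 ∨ Z1 then 1 else 0) *
          ((if O2 then 1 else 0) - (if O1 ∨ (C1 ∧ Rz1) ∨ (Y1 ∧ Rb1) then 1 else 0)) +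
        (if A1 then 0 else 1) * (if A2 ∨ (B2 ∧ Y2) ∨ (Z2 ∧ C2) then 0 else 1) *
          (if B1 then 1 else 0) *
          ((if O2 ∨ (C2 ∧ Rz2) ∨ (Y2 ∧ Rb2) then 1 else 0) - (if O1 then 1 else 0)) -
        (if A1 then 0 else 1) * (if A2 then 0 else 1) * (if B1 then 1 else 0) *
          ((if O2 then 1 else 0) - (if O1 then 1 else 0)) =
      (if A1 then 0 else 1) * (if A2 then 0 else 1) * (if B1 then 1 else 0) *
          (1 - (if Y1 then 1 else 0)) * ((if O2 then 1 else 0) - (if O1 then 1 else 0)) +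
        (if A1 then 0 else 1) * (if A2 then 0 else 1) * (if Z1 then 1 else 0) *
          (1 - (if B1 then 1 else 0)) * (1 - (if C1 then 1 else 0)) *
          ((if O2 then 1 else 0) - (if O1 then 1 else 0)) +
        (if A1 then 0 else 1) * (if A2 then 0 else 1) * (if B1 then 1 else 0) *
          ((1 - (1 - (if O2 then 1 else 0)) * (1 - (if C2 then 1 else 0) * (if Rz2 then 1 else 0)) *
            (1 - (if Y2 then 1 else 0) * (if Rb2 then 1 else 0))) - (if O2 then 1 else 0)) -
        (if A1 then 0 else 1) * (if A2 then 0 else 1) * (if B1 then 1 else 0) *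
          ((if B2 then 1 else 0) * (if Y2 then 1 else 0) + (if Z2 then 1 else 0) * (if C2 then 1 else 0)) *
          ((1 - (1 - (if O2 then 1 else 0)) * (1 - (if C2 then 1 else 0) * (if Rz2 then 1 else 0)) *
            (1 - (if Y2 then 1 else 0) * (if Rb2 then 1 else 0))) - (if O1 then 1 else 0)) := by
  have hC1 : ¬ C1 := fun h => hA1 (hBC1 hB1 h)
  by_cases hY1 : Y1 <;> by_cases hB2 : B2 <;> by_cases hZ2 : Z2 <;> by_cases hC2 : C2 <;>
    by_cases hY2 : Y2 <;>
    first
    | exact absurd (hBC2 ‹B2› ‹C2›) hA2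
    | exact absurd (hZY2 ‹Z2› ‹Y2›) hA2
    | (simp only [hA1, hA2, hB1, hC1, hY1, hB2, hZ2, hC2, hY2, ite_or_eq, if_true, if_false, true_or,
        or_true, false_or, or_false, true_and, and_true, false_and, and_false, sub_self, mul_zero,
        zero_mul, mul_one, one_mul, sub_zero, zero_sub, add_zero, zero_add]
       ring)

omit [Fintype E] in
/-- The Boolean core of Theorem T, the case `b ∉ K_b`, `z ∈ K_b` (`¬ B1`, `Z1`). -/
lemma unmarked_key_Z1 (A1 A2 B1 Z1 C1 Y1 O1 B2 Z2 C2 Y2 O2 Rb1 Rz1 Rb2 Rz2 : Prop)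
    [Decidable A1] [Decidable A2] [Decidable B1] [Decidable Z1] [Decidable C1] [Decidable Y1]
    [Decidable O1] [Decidable B2] [Decidable Z2] [Decidable C2] [Decidable Y2] [Decidable O2]
    [Decidable Rb1] [Decidable Rz1] [Decidable Rb2] [Decidable Rz2]
    (hZY1 : Z1 → Y1 → A1) (hA1 : ¬ A1) (hA2 : ¬ A2) (hB1 : ¬ B1) (hZ1 : Z1) :
    (if A1 ∨ (B1 ∧ Y1) ∨ (Z1 ∧ C1) then (0 : R) else 1) * (if A2 then 0 else 1) *
          (if B1 ∨ Z1 then 1 else 0) *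
          ((if O2 then 1 else 0) - (if O1 ∨ (C1 ∧ Rz1) ∨ (Y1 ∧ Rb1) then 1 else 0)) +
        (if A1 then 0 else 1) * (if A2 ∨ (B2 ∧ Y2) ∨ (Z2 ∧ C2) then 0 else 1) *
          (if B1 then 1 else 0) *
          ((if O2 ∨ (C2 ∧ Rz2) ∨ (Y2 ∧ Rb2) then 1 else 0) - (if O1 then 1 else 0)) -
        (if A1 then 0 else 1) * (if A2 then 0 else 1) * (if B1 then 1 else 0) *
          ((if O2 then 1 else 0) - (if O1 then 1 else 0)) =
      (if A1 then 0 else 1) * (if A2 then 0 else 1) * (if B1 then 1 else 0) *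
          (1 - (if Y1 then 1 else 0)) * ((if O2 then 1 else 0) - (if O1 then 1 else 0)) +
        (if A1 then 0 else 1) * (if A2 then 0 else 1) * (if Z1 then 1 else 0) *
          (1 - (if B1 then 1 else 0)) * (1 - (if C1 then 1 else 0)) *
          ((if O2 then 1 else 0) - (if O1 then 1 else 0)) +
        (if A1 then 0 else 1) * (if A2 then 0 else 1) * (if B1 then 1 else 0) *
          ((1 - (1 - (if O2 then 1 else 0)) * (1 - (if C2 then 1 else 0) * (if Rz2 then 1 else 0)) *
            (1 - (if Y2 then 1 else 0) * (if Rb2 then 1 else 0))) - (if O2 then 1 else 0)) -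
        (if A1 then 0 else 1) * (if A2 then 0 else 1) * (if B1 then 1 else 0) *
          ((if B2 then 1 else 0) * (if Y2 then 1 else 0) + (if Z2 then 1 else 0) * (if C2 then 1 else 0)) *
          ((1 - (1 - (if O2 then 1 else 0)) * (1 - (if C2 then 1 else 0) * (if Rz2 then 1 else 0)) *
            (1 - (if Y2 then 1 else 0) * (if Rb2 then 1 else 0))) - (if O1 then 1 else 0)) := by
  have hY1 : ¬ Y1 := fun h => hA1 (hZY1 hZ1 h)
  by_cases hC1 : C1
  · simp only [hA1, hA2, hB1, hZ1, hC1, hY1, if_true, if_false, or_true, false_or, or_false, true_and,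
      and_true, false_and, and_false, sub_self, mul_zero, zero_mul, mul_one, one_mul, sub_zero,
      add_zero]
  · simp only [hA1, hA2, hB1, hZ1, hC1, hY1, ite_or_eq, ite_and_eq, if_true, if_false, or_true,
      false_or, or_false, false_and, and_false, mul_zero, zero_mul, mul_one, one_mul, sub_zero,
      add_zero, zero_add]

omit [Fintype E] in
/-- The Boolean core of Theorem T.  `A1 = a₁ ↔_y a₂`, `A2 = a₁ ↔_w a₂`; `B1 = a₁ ↔_y b`,
`Z1 = a₁ ↔_y z`, `C1 = a₂ ↔_y b`, `Y1 = a₂ ↔_y z`, `O1 = a₂ ↔_y o`, and `B2, Z2, C2, Y2, O2` the same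
in the red copy `w`; `Rb1, Rz1, Rb2, Rz2` the connections `b ↔ o`, `z ↔ o` in the two copies; the
hypotheses are transitivity. -/
lemma unmarked_key (A1 A2 B1 Z1 C1 Y1 O1 B2 Z2 C2 Y2 O2 Rb1 Rz1 Rb2 Rz2 : Prop)
    [Decidable A1] [Decidable A2] [Decidable B1] [Decidable Z1] [Decidable C1] [Decidable Y1]
    [Decidable O1] [Decidable B2] [Decidable Z2] [Decidable C2] [Decidable Y2] [Decidable O2]
    [Decidable Rb1] [Decidable Rz1] [Decidable Rb2] [Decidable Rz2]
    (hBC1 : B1 → C1 → A1) (hZY1 : Z1 → Y1 → A1) (hBC2 : B2 → C2 → A2) (hZY2 : Z2 → Y2 → A2) :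
    (if A1 ∨ (B1 ∧ Y1) ∨ (Z1 ∧ C1) then (0 : R) else 1) * (if A2 then 0 else 1) *
          (if B1 ∨ Z1 then 1 else 0) *
          ((if O2 then 1 else 0) - (if O1 ∨ (C1 ∧ Rz1) ∨ (Y1 ∧ Rb1) then 1 else 0)) +
        (if A1 then 0 else 1) * (if A2 ∨ (B2 ∧ Y2) ∨ (Z2 ∧ C2) then 0 else 1) *
          (if B1 then 1 else 0) *
          ((if O2 ∨ (C2 ∧ Rz2) ∨ (Y2 ∧ Rb2) then 1 else 0) - (if O1 then 1 else 0)) -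
        (if A1 then 0 else 1) * (if A2 then 0 else 1) * (if B1 then 1 else 0) *
          ((if O2 then 1 else 0) - (if O1 then 1 else 0)) =
      (if A1 then 0 else 1) * (if A2 then 0 else 1) * (if B1 then 1 else 0) *
          (1 - (if Y1 then 1 else 0)) * ((if O2 then 1 else 0) - (if O1 then 1 else 0)) +
        (if A1 then 0 else 1) * (if A2 then 0 else 1) * (if Z1 then 1 else 0) *
          (1 - (if B1 then 1 else 0)) * (1 - (if C1 then 1 else 0)) *
          ((if O2 then 1 else 0) - (if O1 then 1 else 0)) +
        (if A1 then 0 else 1) * (if A2 then 0 else 1) * (if B1 then 1 else 0) *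
          ((1 - (1 - (if O2 then 1 else 0)) * (1 - (if C2 then 1 else 0) * (if Rz2 then 1 else 0)) *
            (1 - (if Y2 then 1 else 0) * (if Rb2 then 1 else 0))) - (if O2 then 1 else 0)) -
        (if A1 then 0 else 1) * (if A2 then 0 else 1) * (if B1 then 1 else 0) *
          ((if B2 then 1 else 0) * (if Y2 then 1 else 0) + (if Z2 then 1 else 0) * (if C2 then 1 else 0)) *
          ((1 - (1 - (if O2 then 1 else 0)) * (1 - (if C2 then 1 else 0) * (if Rz2 then 1 else 0)) *
            (1 - (if Y2 then 1 else 0) * (if Rb2 then 1 else 0))) - (if O1 then 1 else 0)) := by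
  by_cases hA1 : A1
  · simp [hA1]
  by_cases hA2 : A2
  · simp [hA2]
  by_cases hB1 : B1
  · exact unmarked_key_B1 A1 A2 B1 Z1 C1 Y1 O1 B2 Z2 C2 Y2 O2 Rb1 Rz1 Rb2 Rz2 hBC1 hBC2 hZY2 hA1 hA2
      hB1
  by_cases hZ1 : Z1
  · exact unmarked_key_Z1 A1 A2 B1 Z1 C1 Y1 O1 B2 Z2 C2 Y2 O2 Rb1 Rz1 Rb2 Rz2 hZY1 hA1 hA2 hB1 hZ1
  simp [hA1, hA2, hB1, hZ1]

omit [Fintype E] in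
/-- The defect of the edge `b z` at a pair with the edge closed in both copies is
`FAV + PIV + CAP − LOSS`. -/
lemma markEdgeDefect_unmarked_eq (he : ends e = s(b, z)) (y₂ w₂ : Config E) (hy : y₂ e = false)
    (hw : w₂ e = false) :
    (markEdgeDefect ends e a₁ a₂ b o y₂ w₂ : R) =
      unmFav ends a₁ a₂ b o z y₂ w₂ + unmPivot ends a₁ a₂ b o z y₂ w₂ +
        unmCapture ends a₁ a₂ b o z y₂ w₂ - unmLoss ends a₁ a₂ b o z y₂ w₂ := by
  classical
  have hy' := conn_update_true_iff (ends := ends) he hy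
  have hw' := conn_update_true_iff (ends := ends) he hw
  have hQy' : Conn ends (Function.update y₂ e true) a₁ a₂ ↔
      Conn ends y₂ a₁ a₂ ∨ (Conn ends y₂ a₁ b ∧ Conn ends y₂ a₂ z) ∨
        (Conn ends y₂ a₁ z ∧ Conn ends y₂ a₂ b) := by
    rw [hy' a₁ a₂]
    constructor
    · rintro (h | ⟨h1, h2⟩ | ⟨h1, h2⟩)
      · exact Or.inl h
      · exact Or.inr (Or.inl ⟨h1, conn_symm h2⟩)
      · exact Or.inr (Or.inr ⟨h1, conn_symm h2⟩)
    · rintro (h | ⟨h1, h2⟩ | ⟨h1, h2⟩)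
      · exact Or.inl h
      · exact Or.inr (Or.inl ⟨h1, conn_symm h2⟩)
      · exact Or.inr (Or.inr ⟨h1, conn_symm h2⟩)
  have hLy' : Conn ends (Function.update y₂ e true) a₁ b ↔
      Conn ends y₂ a₁ b ∨ Conn ends y₂ a₁ z := by
    rw [hy' a₁ b]
    constructor
    · rintro (h | ⟨h1, _⟩ | ⟨h1, _⟩)
      · exact Or.inl h
      · exact Or.inl h1
      · exact Or.inr h1
    · rintro (h | h)
      · exact Or.inl h
      · exact Or.inr (Or.inr ⟨h, conn_refl _ _ _⟩)
  have hHy' : Conn ends (Function.update y₂ e true) a₂ o ↔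
      Conn ends y₂ a₂ o ∨ (Conn ends y₂ a₂ b ∧ Conn ends y₂ z o) ∨
        (Conn ends y₂ a₂ z ∧ Conn ends y₂ b o) := hy' a₂ o
  have hQw' : Conn ends (Function.update w₂ e true) a₁ a₂ ↔
      Conn ends w₂ a₁ a₂ ∨ (Conn ends w₂ a₁ b ∧ Conn ends w₂ a₂ z) ∨
        (Conn ends w₂ a₁ z ∧ Conn ends w₂ a₂ b) := by
    rw [hw' a₁ a₂]
    constructor
    · rintro (h | ⟨h1, h2⟩ | ⟨h1, h2⟩)
      · exact Or.inl h
      · exact Or.inr (Or.inl ⟨h1, conn_symm h2⟩)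
      · exact Or.inr (Or.inr ⟨h1, conn_symm h2⟩)
    · rintro (h | ⟨h1, h2⟩ | ⟨h1, h2⟩)
      · exact Or.inl h
      · exact Or.inr (Or.inl ⟨h1, conn_symm h2⟩)
      · exact Or.inr (Or.inr ⟨h1, conn_symm h2⟩)
  have hHw' : Conn ends (Function.update w₂ e true) a₂ o ↔
      Conn ends w₂ a₂ o ∨ (Conn ends w₂ a₂ b ∧ Conn ends w₂ z o) ∨
        (Conn ends w₂ a₂ z ∧ Conn ends w₂ b o) := hw' a₂ o
  simp only [markEdgeDefect, foldK, unmFav, unmPivot, unmCapture, unmLoss, capInd, iQ_eq_ite',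
    iL_eq_ite', iH_eq_ite', hQy', hLy', hHy', hQw', hHw']
  exact unmarked_key (Conn ends y₂ a₁ a₂) (Conn ends w₂ a₁ a₂) (Conn ends y₂ a₁ b)
    (Conn ends y₂ a₁ z) (Conn ends y₂ a₂ b) (Conn ends y₂ a₂ z) (Conn ends y₂ a₂ o)
    (Conn ends w₂ a₁ b) (Conn ends w₂ a₁ z) (Conn ends w₂ a₂ b) (Conn ends w₂ a₂ z)
    (Conn ends w₂ a₂ o) (Conn ends y₂ b o) (Conn ends y₂ z o) (Conn ends w₂ b o) (Conn ends w₂ z o)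
    (fun h1 h2 => conn_trans h1 (conn_symm h2)) (fun h1 h2 => conn_trans h1 (conn_symm h2))
    (fun h1 h2 => conn_trans h1 (conn_symm h2)) (fun h1 h2 => conn_trans h1 (conn_symm h2))

/-- **THEOREM T — the exact four-piece defect of the unmarked edge at the mark**:
`D(G) = D(G − b z) + FAV + PIV + CAP − LOSS` at every profile in which `b z` is free (the four
pieces at the profile with the edge closed). -/
theorem pairCount_foldK_unmarkedEdge (he : ends e = s(b, z)) (F : Finset E) (z₀ : Config E)
    (heF : e ∈ F) :
    pairCount F z₀ (foldK ends a₁ a₂ b o : Config E → Config E → R) =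
      pairCount (F.erase e) (Function.update z₀ e false) (foldK ends a₁ a₂ b o) +
        pairCount (F.erase e) (Function.update z₀ e false) (unmFav ends a₁ a₂ b o z) +
        pairCount (F.erase e) (Function.update z₀ e false) (unmPivot ends a₁ a₂ b o z) +
        pairCount (F.erase e) (Function.update z₀ e false) (unmCapture ends a₁ a₂ b o z) -
        pairCount (F.erase e) (Function.update z₀ e false) (unmLoss ends a₁ a₂ b o z) := by
  classical
  rw [pairCount_foldK_markEdge F z₀ heF]
  have hsplit : pairCount (F.erase e) (Function.update z₀ e false)
      (markEdgeDefect ends e a₁ a₂ b o : Config E → Config E → R) =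
      pairCount (F.erase e) (Function.update z₀ e false) (unmFav ends a₁ a₂ b o z) +
        pairCount (F.erase e) (Function.update z₀ e false) (unmPivot ends a₁ a₂ b o z) +
        pairCount (F.erase e) (Function.update z₀ e false) (unmCapture ends a₁ a₂ b o z) -
        pairCount (F.erase e) (Function.update z₀ e false) (unmLoss ends a₁ a₂ b o z) := by
    unfold pairCount
    rw [← Finset.sum_add_distrib, ← Finset.sum_add_distrib, ← Finset.sum_sub_distrib]
    refine Finset.sum_congr rfl fun y₂ _ => ?_
    by_cases hadm : ∀ f, f ∉ F.erase e → y₂ f = Function.update z₀ e false f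
    · rw [if_pos hadm, if_pos hadm, if_pos hadm, if_pos hadm, if_pos hadm]
      have hy₂ : y₂ e = false := by
        have := hadm e (Finset.notMem_erase e F)
        rwa [Function.update_self] at this
      have hw₂ : A3InactiveTyped.flipOn (F.erase e) y₂ e = false := by
        rw [A3InactiveTyped.flipOn_of_notMem (Finset.notMem_erase e F)]; exact hy₂
      exact markEdgeDefect_unmarked_eq he y₂ _ hy₂ hw₂
    · rw [if_neg hadm, if_neg hadm, if_neg hadm, if_neg hadm, if_neg hadm]
      ring
  rw [hsplit]
  ring

omit [Fintype E] [DecidableEq E] in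
/-- The capture piece is pointwise nonnegative: `1[o ∈ M_r′] ≥ 1[o ∈ M_r]`. -/
lemma unmCapture_nonneg [LinearOrder R] [IsStrictOrderedRing R] (y w : Config E) :
    (0 : R) ≤ unmCapture ends a₁ a₂ b o z y w := by
  classical
  simp only [unmCapture, capInd, iQ_eq_ite', iL_eq_ite', iH_eq_ite']
  split_ifs <;> norm_num

end UnmarkedEdge

end TB14Cut

end Summit.Ventures.PercRepro2
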